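import Summits.BirchSwinnertonDyer.BirchSwinnertonDyer.Theses.UniversalToricDescent
import Summits.BirchSwinnertonDyer.BirchSwinnertonDyer.Theorems.UniversalToricDescentDefectTransportOfSigmaCongruence
import Summits.BirchSwinnertonDyer.BirchSwinnertonDyer.Theorems.UniversalToricDescentDefectTransportTwinTowerOnBadSet
import Summits.BirchSwinnertonDyer.BirchSwinnertonDyer.Theorems.UniversalToricDescentDefectTransportModThreePTStubOneSidedGlue
import Summits.BirchSwinnertonDyer.BirchSwinnertonDyer.Theorems.UniversalToricDescentDefectTransportModThreePTStubTwinStrictSurj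
import Summits.BirchSwinnertonDyer.BirchSwinnertonDyer.Theorems.UniversalToricDescentDefectTransportModThreePTStubTwinSignatureTorsion
import Summits.BirchSwinnertonDyer.BirchSwinnertonDyer.Theorems.UniversalToricDescentDefectTransportModThreePTStubTwinSigmaSurjOfCount
import Summits.BirchSwinnertonDyer.BirchSwinnertonDyer.Theorems.UniversalToricDescentDefectTransportModThreePTStubLocalH1Divisible
import Summits.BirchSwinnertonDyer.BirchSwinnertonDyer.Theorems.UniversalToricDescentDefectTransportModThreePTStubLocalTorsionCountAtTame
import Summits.BirchSwinnertonDyer.BirchSwinnertonDyer.Theorems.UniversalToricDescentDefectTransportModThreePTStubCountOfRelaxedImage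
import Summits.BirchSwinnertonDyer.BirchSwinnertonDyer.Theorems.UniversalToricDescentDefectTransportModThreePTStubRelaxedImageCount
import HarnessLib

/-!
# Item B″ `DefectTransportModThreePTOfSigmaCongruence` (stmt-BirchSwinnertonDyer-27121), PROVED:
# `SigmaCongruenceAtThree → DefectTransportModThreePT` — route `UniversalToricDescent`

The support item B″ of the crux ♭T≤ `DefectTransportModThreePT` (stmt-BirchSwinnertonDyer-23042): the Σ-depleted congruence A of the
BDP frames (`SigmaCongruenceAtThree`, the research item stmt-BirchSwinnertonDyer-27120, taken here as the HYPOTHESIS) implies the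
one-sided defect transport ♭T≤.  This file is the line `sigmacongruence`'s registered skeleton
(`Cruxes/DefectTransportModThreePT/Lines/sigmacongruence.lean`, v9 sha16 1bb2faab747a10b8 → v10, leads `bsd-wall-utd-p1` g12–g18) with
EVERY stub now a landed theorem and the one research stub A turned into the hypothesis `hA` (the skeleton's `stub_sigmaCongruence` is
`SigmaCongruenceAtThree` minus the frame hypothesis `μ(𝓛′) = 0`, which ♭T≤ supplies as `hi′`):

* TS2-COUNT `twinSigmaCount` (= item stmt-BirchSwinnertonDyer-23850) from R2 `stub_countOfRelaxedImage` (width `utd-p1-w2` g1, p686469),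
  R1 `stub_relaxedImageCount` (lead g18, the RELAXED COUNT ROAD) and R3 `stub_localTorsionCountAtTame` (width g1/g2, p689873);
* TS2′ `twinSigmaSurj` from TS2-COUNT + TS2-DIV `stub_localH1Divisible` (width g0, p680853) + TS2-TORS `stub_twinSignatureTorsion`
  (p677052) through TS2-ASSEMBLY `stub_twinSigmaSurjOfCount` (p679520);
* B′≤ `oneSidedTransport` from TS1′ `stub_twinStrictSurj` (p674266) + TS2′ through the one-sided glue G≤ `stub_oneSidedGlue` (p656132);
* `defectTransportModThreePT_of_sigmaCongruenceAtThree` : A → ♭T≤ (composition, lead g12–g16: `exists_normProfile_of_sigmaCongruence`,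
  `analyticIdentity_of_sigmaCongruence`, `omega`), and the item's deciding theorem `defectTransportModThreePTOfSigmaCongruence_proof`.

Width seat `bsd-wall-utd-p1-w2` g4 (assembly only; the mathematics is the leads' and the width seats' landed files).  THEOREMS ONLY
(no definition, no named fact, no `sorry`); the two Poitou–Tate route decls remain HYPOTHESES inside ♭T≤'s text.  The crux ♭T≤ itself
stays OPEN (it needs A = stmt-BirchSwinnertonDyer-27120).  BSD is not proved by any of this.

References: [GreenbergVatsal2000] Thm. (1.4), §2 Prop. (2.1), Cor. (2.3), Prop. (2.4), (2.8); [LeiMullerXia2023] §3 (Lemma 3.3, 3.4,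
Cor. 3.8), Thm. 5.1; [MilneADT2006] I Thm. 4.10.
-/


noncomputable section

open scoped Classical

set_option linter.dupNamespace false
set_option autoImplicit false

namespace Summit.BirchSwinnertonDyer.BirchSwinnertonDyer.Theorems.UniversalToricDescentDefectTransportModThreePTOfSigmaCongruence

open PowerSeries WeierstrassCurve NumberField IsDedekindDomain Field Polynomial
  Literature.NumberTheory.EllipticCurves
  Literature.NumberTheory.EllipticCurves.ModularForms
  Literature.NumberTheory.EllipticCurves.Rank1Residual
  Literature.NumberTheory.EllipticCurves.GreenbergSelmer
  Literature.NumberTheory.EllipticCurves.IwasawaAlgebra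
  Literature.NumberTheory.GaloisRepresentations Literature.NumberTheory.GaloisCohomology
  Summit.BirchSwinnertonDyer.Rank1Residual Summit.BirchSwinnertonDyer.Rank1Residual.X11b
  Summit.BirchSwinnertonDyer.Rank1Residual.X11b.AcSelmer Summit.BirchSwinnertonDyer.Rank1Residual.X11b.Coinv
  Summit.BirchSwinnertonDyer.Rank1Residual.Iwasawa
  Summit.BirchSwinnertonDyer.BirchSwinnertonDyer.Theorems
  Summit.BirchSwinnertonDyer.BirchSwinnertonDyer.Theorems.SchneiderFree
  Summit.BirchSwinnertonDyer.BirchSwinnertonDyer.Theorems.UniversalToricDescentDefectTransport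
  Summit.BirchSwinnertonDyer.BirchSwinnertonDyer.Theorems.UniversalToricDescentNormProfile
  Summit.BirchSwinnertonDyer.BirchSwinnertonDyer.Theorems.UniversalToricDescentSigmaLocalImage
  Summit.BirchSwinnertonDyer.BirchSwinnertonDyer.Theorems.UniversalToricDescentSigmaLocalStabilizer
  Summit.BirchSwinnertonDyer.BirchSwinnertonDyer.Theorems.UniversalToricDescentSigmaCoinvariants
  Summit.BirchSwinnertonDyer.BirchSwinnertonDyer.Theorems.UniversalToricDescentAcDualMuZero
  Summit.BirchSwinnertonDyer.BirchSwinnertonDyer.Theorems.UniversalToricDescentResidualSelmer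
  Summit.BirchSwinnertonDyer.BirchSwinnertonDyer.Theorems.UniversalToricDescentSigmaPassage
  Summit.BirchSwinnertonDyer.BirchSwinnertonDyer.Theorems.UniversalToricDescentNoFiniteSubmodule
  Summit.BirchSwinnertonDyer.BirchSwinnertonDyer.Theorems.UniversalToricDescentSigmaFree
  Summit.BirchSwinnertonDyer.BirchSwinnertonDyer.Cruxes.DefectTransportModThreePT.SigmaCongruence

/-- TS2-COUNT (= item stmt-BirchSwinnertonDyer-23850, the skeleton's `stub_twinSigmaCount`; DERIVED — from the LANDED stubs R3 `stub_localTorsionCountAtTame`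
(p689873) and R1 `stub_relaxedImageCount` through R2 `stub_countOfRelaxedImage` (p686469); statement = v6 g17 — the Poitou–Tate CONTENT of TS2′, as a k-UNIFORM COUNT):
there is a constant `C` such that for every `k` and every finite set `Φ` of `3^k`-torsion `v`-signatures
(right-`ker κ`-invariant, left-`D_v`-equivariant `F : Γ_K → H¹(kerD κ v, E′_K[3^∞])`),
`#Sel_{𝔭′}^{S}(K_∞)[3^k] · #Φ ≤ C · #Sel_{𝔭′}^{S∪{v}}(K_∞)[3^k]`.
[cite: GreenbergVatsal2000, §2 Prop. (2.1), Cor. (2.3) (pp. 23–25)] [cite: MilneADT2006, Ch. I, Thm. 4.10, Thm. 2.6] -/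
theorem twinSigmaCount :
    Summit.BirchSwinnertonDyer.BirchSwinnertonDyer.Theses.UniversalToricDescent.PoitouTateSelmerStructureDualityFact →
    Summit.BirchSwinnertonDyer.BirchSwinnertonDyer.Theses.UniversalToricDescent.PoitouTateShaTateDualFact →
    ∀ (W' : WeierstrassCurve ℚ) [W'.IsElliptic] [W'.IsGloballyMinimal] (K : Type) [Field K] [NumberField K],
      ¬ Addv W' 3 → IsImaginaryQuadratic K → SplitsIn K 3 →
      ∀ (κ : ZpExtension K 3), κ.IsAnticyclotomic → ∀ (γ : absoluteGaloisGroup K) [Fact (κ.IsTopGenerator γ)]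
      (𝔭 𝔭' : HeightOneSpectrum (𝓞 K)), ((3 : ℕ) : 𝓞 K) ∈ 𝔭.asIdeal → ((3 : ℕ) : 𝓞 K) ∈ 𝔭'.asIdeal → 𝔭 ≠ 𝔭' →
      (∀ m : (W'.baseChange K).geomPrimaryTorsion 3, (∀ σ ∈ κ.kerSubgroup, σ • m = m) → 3 • m = 0 → m = 0) →
      ∀ (S : Set (HeightOneSpectrum (𝓞 K))), S.Finite →
      (∀ v ∈ S, ((3 : ℕ) : 𝓞 K) ∉ v.asIdeal ∧ ¬ (decomp v ≤ κ.kerSubgroup)) →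
      ∀ (v : HeightOneSpectrum (𝓞 K)), ((3 : ℕ) : 𝓞 K) ∉ v.asIdeal → v ∉ S → ¬ (decomp v ≤ κ.kerSubgroup) →
      Set.Finite {s : selmerAc (W'.baseChange K) 3 κ 𝔭' (insert v S) | 3 • s = 0} →
      ∃ C : ℕ, ∀ (k : ℕ) (Φ : Finset (absoluteGaloisGroup K → subgroupH1 (kerD κ v) ((W'.baseChange K).geomPrimaryTorsion 3))),
        (∀ F ∈ Φ, (∀ (σ h : absoluteGaloisGroup K), h ∈ κ.kerSubgroup → F (σ * h) = F σ) ∧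
          (∀ (d : decomp (K := K) v) (σ : absoluteGaloisGroup K), F ((d : absoluteGaloisGroup K) * σ) =
            conjH1 (kerD κ v) ((W'.baseChange K).geomPrimaryTorsion 3) d (F σ)) ∧ 3 ^ k • F = 0) →
        Nat.card {s : selmerAc (W'.baseChange K) 3 κ 𝔭' S // 3 ^ k • s = 0} * Φ.card ≤
          C * Nat.card {s : selmerAc (W'.baseChange K) 3 κ 𝔭' (insert v S) // 3 ^ k • s = 0} := by
  intro hPT hSha W' _ _ K _ _ h3 hK hsp κ hκ γ _ 𝔭 𝔭' h𝔭 h𝔭' hne htor S hS hSd v hv hvS hvd hfin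
  exact stub_countOfRelaxedImage hPT hSha W' K h3 hK hsp κ hκ γ 𝔭 𝔭' h𝔭 h𝔭' hne htor S hS hSd v hv hvS hvd hfin
    (fun v₀ hv₀ hv₀S c d₁ hd₁ hc hdvd ↦
      stub_relaxedImageCount hPT W' K h3 hK hsp κ hκ γ 𝔭 𝔭' h𝔭 h𝔭' hne htor S hS hSd v hv hvS hvd hfin v₀ hv₀ hv₀S c d₁
        hd₁ hc hdvd (stub_localTorsionCountAtTame W' K κ v hv hvd))

/-- TS2′ (DERIVED, as in skeleton v8: TS2-TORS = landed p677052, TS2-ASSEMBLY = landed `…StubTwinSigmaSurjOfCount`, TS2-DIV = landed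
`…StubLocalH1Divisible` (width utd-p1-w2 g0, 2026-08-29)) — (Σ′), Greenberg–Vatsal Cor. 2.3 FOR THE TWIN, rank-free: for a finitely
decomposed `v ∤ 3`, `v ∉ S`, every right-`ker κ`-invariant left-`D_v`-equivariant `F : Γ_K → H¹(kerD κ v, E′_K[3^∞])` is
the `v`-signature of some `s ∈ Sel_{𝔭′}^{S∪{v}}(K_∞, E′_K[3^∞])`.  From TS2-COUNT + TS2-DIV + TS2-TORS through TS2-ASSEMBLY.
[cite: GreenbergVatsal2000, §2 Cor. (2.3) (pp. 24–25)] -/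
theorem twinSigmaSurj :
    Summit.BirchSwinnertonDyer.BirchSwinnertonDyer.Theses.UniversalToricDescent.PoitouTateSelmerStructureDualityFact →
    Summit.BirchSwinnertonDyer.BirchSwinnertonDyer.Theses.UniversalToricDescent.PoitouTateShaTateDualFact →
    ∀ (W' : WeierstrassCurve ℚ) [W'.IsElliptic] [W'.IsGloballyMinimal] (K : Type) [Field K] [NumberField K],
      ¬ Addv W' 3 → IsImaginaryQuadratic K → SplitsIn K 3 →
      ∀ (κ : ZpExtension K 3), κ.IsAnticyclotomic → ∀ (γ : absoluteGaloisGroup K) [Fact (κ.IsTopGenerator γ)]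
      (𝔭 𝔭' : HeightOneSpectrum (𝓞 K)), ((3 : ℕ) : 𝓞 K) ∈ 𝔭.asIdeal → ((3 : ℕ) : 𝓞 K) ∈ 𝔭'.asIdeal → 𝔭 ≠ 𝔭' →
      (∀ m : (W'.baseChange K).geomPrimaryTorsion 3, (∀ σ ∈ κ.kerSubgroup, σ • m = m) → 3 • m = 0 → m = 0) →
      ∀ (S : Set (HeightOneSpectrum (𝓞 K))), S.Finite →
      (∀ v ∈ S, ((3 : ℕ) : 𝓞 K) ∉ v.asIdeal ∧ ¬ (decomp v ≤ κ.kerSubgroup)) →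
      ∀ (v : HeightOneSpectrum (𝓞 K)), ((3 : ℕ) : 𝓞 K) ∉ v.asIdeal → v ∉ S → ¬ (decomp v ≤ κ.kerSubgroup) →
      Set.Finite {s : selmerAc (W'.baseChange K) 3 κ 𝔭' (insert v S) | 3 • s = 0} →
      ∀ (F : (absoluteGaloisGroup K → subgroupH1 (kerD κ v) ((W'.baseChange K).geomPrimaryTorsion 3))),
      (∀ (σ h : absoluteGaloisGroup K), h ∈ κ.kerSubgroup → F (σ * h) = F σ) →
      (∀ (d : decomp (K := K) v) (σ : absoluteGaloisGroup K), F ((d : absoluteGaloisGroup K) * σ) =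
        conjH1 (kerD κ v) ((W'.baseChange K).geomPrimaryTorsion 3) d (F σ)) →
      ∃ s ∈ selmerAc (W'.baseChange K) 3 κ 𝔭' (insert v S), ∀ σ : absoluteGaloisGroup K,
        resKerD κ ((W'.baseChange K).geomPrimaryTorsion 3) v ((W'.baseChange K).conjH1 3 κ.kerSubgroup σ s) = F σ := by
  intro hPT hSha W' _ _ K _ _ h3 hK hsp κ hκ γ _ 𝔭 𝔭' h𝔭 h𝔭' hne htor S hS hSd v hv hvS hvd hfin F hFH hFD
  exact stub_twinSigmaSurjOfCount hPT hSha W' K h3 hK hsp κ hκ γ 𝔭 𝔭' h𝔭 h𝔭' hne htor S hS hSd v hv hvS hvd hfin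
    (twinSigmaCount hPT hSha W' K h3 hK hsp κ hκ γ 𝔭 𝔭' h𝔭 h𝔭' hne htor S hS hSd v hv hvS hvd hfin)
    (stub_localH1Divisible W' K κ v hv hvd) (stub_twinSignatureTorsion W' K κ v hv hvd) F hFH hFD

/-- B′≤ (DERIVED, as in skeleton v4a, lead g16): **the ONE-SIDED λ-transport for `X_{∅,0}` along `E[3] ≅ E′[3]`,
rank-free** — from TS1′ + TS2′ through the glue G≤ (bad set `Σ_bad`, `3` split from the additive `3 ∣ N` and the Heegner
hypothesis, the conjugate prime, `μ(X_E) = 0` from the wall, `Sel^{Σ_bad}(E)[3]` finite, residual transfer to `E′` (GV Prop. 2.8),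
`E′(K_∞)[3] = 0` from `ρ̄_{E,3}` onto). Statement = v3's B′ with the last conjunct `λ + Σ = λ′ + Σ′` ↦ `λ′ + Σ′ ≤ λ + Σ`.
[cite: GreenbergVatsal2000, Thm. (1.4), §2 Prop. (2.1), (2.4), (2.8), (2.10)] [cite: LeiMullerXia2023, Lemma 3.3, 3.4, Cor. 3.8] -/
theorem oneSidedTransport :
    Summit.BirchSwinnertonDyer.BirchSwinnertonDyer.Theses.UniversalToricDescent.PoitouTateSelmerStructureDualityFact →
    Summit.BirchSwinnertonDyer.BirchSwinnertonDyer.Theses.UniversalToricDescent.PoitouTateShaTateDualFact →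
    ∀ (W : WeierstrassCurve ℚ) [W.IsElliptic] [W.IsGloballyMinimal] (W' : WeierstrassCurve ℚ) [W'.IsElliptic]
      [W'.IsGloballyMinimal] (N N' : ℕ) (K : Type) [Field K] [NumberField K],
      Additive.ClassO6 W 3 → W.HasSurjectiveModNGaloisRep 3 → W.analyticRank = 1 → W.conductorNorm ℤ = N →
      O6.ModPCongruent W' W 3 → ¬ Addv W' 3 → W'.conductorNorm ℤ = N' → IsImaginaryQuadratic K →
      SatisfiesHeegnerHypothesis N K → SatisfiesHeegnerHypothesis N' K →
      (∀ v : HeightOneSpectrum (𝓞 K), ((3 : ℕ) : 𝓞 K) ∈ v.asIdeal → Finite (selmerAcBase (W.baseChange K) 3 v ∅)) →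
      ∀ (κ : ZpExtension K 3), κ.IsAnticyclotomic → ∀ (γ : absoluteGaloisGroup K) [Fact (κ.IsTopGenerator γ)]
      (𝔭' : HeightOneSpectrum (𝓞 K)), ((3 : ℕ) : 𝓞 K) ∈ 𝔭'.asIdeal →
      Module.IsTorsion (IwasawaAlgebra 3) (XAc (W.baseChange K) 3 κ 𝔭' ∅ γ) →
      ∀ (L : UnrSeries 3), Ideal.span {L} ≤
        (XAc.charIdeal (W.baseChange K) 3 κ 𝔭' ∅ γ).map (PowerSeries.map (Halves.toUnr 3)) →
      (∃ i : ℕ, ‖((PowerSeries.coeff i L : unrIntegers 3) : ℂ_[3])‖ = 1) →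
      ∃ (T : Finset (HeightOneSpectrum (𝓞 K))) (c s s' : HeightOneSpectrum (𝓞 K) → ℕ),
        (↑T = {v : HeightOneSpectrum (𝓞 K) | ((3 : ℕ) : 𝓞 K) ∉ v.asIdeal ∧
          (¬ (W.baseChange K).HasGoodReductionAt v ∨ ¬ (W'.baseChange K).HasGoodReductionAt v)}) ∧
        (∀ v ∈ T, (∃ d₀ : decomp (K := K) v, (κ (d₀ : absoluteGaloisGroup K)).toAdd = (3 : ℤ_[3]) ^ c v) ∧
          (∀ d : decomp (K := K) v, (3 : ℤ_[3]) ^ c v ∣ (κ (d : absoluteGaloisGroup K)).toAdd) ∧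
          Nat.card {f : subgroupH1 (kerD κ v) ((W.baseChange K).geomPrimaryTorsion 3) // 3 • f = 0} = 3 ^ s v ∧
          Nat.card {f : subgroupH1 (kerD κ v) ((W'.baseChange K).geomPrimaryTorsion 3) // 3 • f = 0} = 3 ^ s' v) ∧
        (∃ g : UnrSeries 3,
          (XAc.charIdeal (W.baseChange K) 3 κ 𝔭' ∅ γ).map (PowerSeries.map (Halves.toUnr 3)) = Ideal.span {g} ∧
            (∀ i < lambdaInvariant 3 (XAc (W.baseChange K) 3 κ 𝔭' ∅ γ),
              ‖((PowerSeries.coeff i g : unrIntegers 3) : ℂ_[3])‖ < 1) ∧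
            ‖((PowerSeries.coeff (lambdaInvariant 3 (XAc (W.baseChange K) 3 κ 𝔭' ∅ γ)) g :
              unrIntegers 3) : ℂ_[3])‖ = 1) ∧
        Module.IsTorsion (IwasawaAlgebra 3) (XAc (W'.baseChange K) 3 κ 𝔭' ∅ γ) ∧
        (∃ g' : UnrSeries 3,
          (XAc.charIdeal (W'.baseChange K) 3 κ 𝔭' ∅ γ).map (PowerSeries.map (Halves.toUnr 3)) = Ideal.span {g'} ∧
            (∀ i < lambdaInvariant 3 (XAc (W'.baseChange K) 3 κ 𝔭' ∅ γ),
              ‖((PowerSeries.coeff i g' : unrIntegers 3) : ℂ_[3])‖ < 1) ∧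
            ‖((PowerSeries.coeff (lambdaInvariant 3 (XAc (W'.baseChange K) 3 κ 𝔭' ∅ γ)) g' :
              unrIntegers 3) : ℂ_[3])‖ = 1) ∧
        lambdaInvariant 3 (XAc (W'.baseChange K) 3 κ 𝔭' ∅ γ) + ∑ v ∈ T, 3 ^ c v * s' v ≤
          lambdaInvariant 3 (XAc (W.baseChange K) 3 κ 𝔭' ∅ γ) + ∑ v ∈ T, 3 ^ c v * s v := by
  intro hPT hPT2 W _ _ W' _ _ N N' K _ _ hO6 hsurj _hr hN hcong hadd' hN' hK hHe hHe' hfin κ hκ γ _ 𝔭' h𝔭' hT L hle hi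
  haveI : Fact (Nat.Prime 3) := ⟨Nat.prime_three⟩
  -- the bad set `Σ_bad`
  set S : Set (HeightOneSpectrum (𝓞 K)) := {v | ((3 : ℕ) : 𝓞 K) ∉ v.asIdeal ∧
    (¬ (W.baseChange K).HasGoodReductionAt v ∨ ¬ (W'.baseChange K).HasGoodReductionAt v)} with hSdef
  have hSfin : S.Finite := by
    refine (((W.baseChange K).finite_badPlaces_holds (𝓞 K)).union
      ((W'.baseChange K).finite_badPlaces_holds (𝓞 K))).subset fun v hv ↦ ?_
    rcases hv.2 with h | h
    · exact Or.inl h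
    · exact Or.inr h
  have hSp : ∀ v ∈ S, ((3 : ℕ) : 𝓞 K) ∉ v.asIdeal := fun v hv ↦ hv.1
  have hSdec : ∀ v ∈ S, ¬ (decomp v ≤ κ.kerSubgroup) := by
    intro v hv
    rcases hv.2 with h | h
    · exact UniversalToricDescentTorsionMuTransportHeegner.not_decomp_le_kerSubgroup_of_not_hasGoodReductionAt_baseChange
        W hN K hK hHe (by decide) κ hκ hv.1 h
    · exact UniversalToricDescentTorsionMuTransportHeegner.not_decomp_le_kerSubgroup_of_not_hasGoodReductionAt_baseChange
        W' hN' K hK hHe' (by decide) κ hκ hv.1 h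
  have hnice : ∀ S' ⊆ S, ∀ v ∈ S', ((3 : ℕ) : 𝓞 K) ∉ v.asIdeal ∧ ¬ (decomp v ≤ κ.kerSubgroup) :=
    fun S' hS' v hv ↦ ⟨hSp v (hS' hv), hSdec v (hS' hv)⟩
  have hgood : ∀ v : HeightOneSpectrum (𝓞 K), v ∉ S → ((3 : ℕ) : 𝓞 K) ∉ v.asIdeal →
      (W.baseChange K).HasGoodReductionAt v := fun v hv hpv ↦ by
    by_contra h; exact hv ⟨hpv, Or.inl h⟩
  have hgood' : ∀ v : HeightOneSpectrum (𝓞 K), v ∉ S → ((3 : ℕ) : 𝓞 K) ∉ v.asIdeal →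
      (W'.baseChange K).HasGoodReductionAt v := fun v hv hpv ↦ by
    by_contra h; exact hv ⟨hpv, Or.inr h⟩
  -- `3` splits in `K`; the conjugate prime `𝔭 ≠ 𝔭′`
  have hadd : Addv W 3 := hO6.2.1
  have hpN : 3 ∣ W.conductorNorm ℤ := (W.dvd_conductorNorm_iff_not_hasGoodReductionAtPrime 3).mpr hadd.1
  have hsplit : SplitsIn K 3 := hHe 3 (Fact.out) (hN ▸ hpN)
  obtain ⟨-, 𝔭, -, hne, h𝔭, -⟩ := LocalIndexTransport.exists_conj_prime_of_splitsIn K 3 hK.1 hsplit h𝔭'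
  -- `Sel_{𝔭′}^{S′}(E′)[3]` finite on `S′ ⊆ Σ_bad`: `μ(X_E) = 0` from the wall, up to `Σ_bad`, residual transfer to `E′`
  haveI := XAc.module_finite κ 𝔭' (∅ : Set (HeightOneSpectrum (𝓞 K))) γ Set.finite_empty (W := W.baseChange K)
  have hμe : muInvariant 3 (XAc (W.baseChange K) 3 κ 𝔭' ∅ γ) = 0 :=
    muInvariant_eq_zero_of_span_le_map_charIdeal (XAc (W.baseChange K) 3 κ 𝔭' ∅ γ) hT hle hi
  have hfine : Set.Finite {s : selmerAc (W.baseChange K) 3 κ 𝔭' ∅ | 3 • s = 0} :=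
    finite_pTorsion_of_muInvariant_eq_zero (W.baseChange K) 3 κ 𝔭' ∅ γ hT hμe
  have hfinS : Set.Finite {s : selmerAc (W.baseChange K) 3 κ 𝔭' S | 3 • s = 0} :=
    finite_selmerAc_pTorsion_of_empty (W.baseChange K) κ hSfin hSp hSdec hfine
  have h𝔭'dec : ¬ (decomp 𝔭' ≤ κ.kerSubgroup) :=
    ZpExtension.decomp_not_le_kerSubgroup_above_of_isAnticyclotomic_holds K 3 hK (by decide) κ hκ 𝔭' h𝔭'
  obtain ⟨e, he⟩ :=
    UniversalToricDescentResidualSelmerTransfer.exists_torsionIso_baseChange_of_modPCongruent (K := K) W W' hcong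
  have hes : ∀ (σ : absoluteGaloisGroup K) (P : (W.baseChange K).geomTorsion (3 : ℤ)),
      e.symm (σ • P) = σ • e.symm P := fun σ P ↦ by
    apply e.injective; rw [e.apply_symm_apply, he, e.apply_symm_apply]
  have hfinS' : Set.Finite {s : selmerAc (W'.baseChange K) 3 κ 𝔭' S | 3 • s = 0} :=
    UniversalToricDescentResidualSelmerTransfer.finite_selmerAc_pTorsion_transfer_of_torsionIso κ (W.baseChange K)
      (W'.baseChange K) (by decide) h𝔭' h𝔭'dec hgood hgood' e.symm hes hfinS
  have hfin𝔭' : ∀ S' ⊆ S, Set.Finite {s : selmerAc (W'.baseChange K) 3 κ 𝔭' S' | 3 • s = 0} :=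
    fun S' hS' ↦ finite_selmerAc_pTorsion_of_subset (W'.baseChange K) 3 κ hS' hfinS'
  -- `E′(K_∞)[3] = 0`
  have hG : ∀ m : (W.baseChange K).geomPrimaryTorsion 3, (∀ σ ∈ κ.kerSubgroup, σ • m = m) → 3 • m = 0 → m = 0 := by
    intro m hm _
    have hmem : m ∈ FixedPoints.addSubgroup κ.kerSubgroup (geomPrimaryTorsion (W.baseChange K) 3) := fun g ↦ hm g g.2
    rw [UniversalToricDescentTowerTorsion.fixedPoints_kerSubgroup_geomPrimaryTorsion_baseChange_eq_bot_of_surjective W 3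
      hsurj K hK κ] at hmem
    exact (AddSubgroup.mem_bot).mp hmem
  have hG' : ∀ m : (W'.baseChange K).geomPrimaryTorsion 3, (∀ σ ∈ κ.kerSubgroup, σ • m = m) → 3 • m = 0 → m = 0 :=
    UniversalToricDescentResidualSelmerExact.noFixedPTorsion_of_torsionIso (W.baseChange K) (W'.baseChange K)
      κ.kerSubgroup e.symm hes hG
  -- the two tower statements about the twin on the subsets of `Σ_bad`, through the LANDED one-sided glue G≤
  refine stub_oneSidedGlue W W' K hO6 hsurj hN hcong hadd' hN' hK hHe hHe' κ hκ γ h𝔭' hT hle hi (hPT K) (hPT2 K) hfin ?_ ?_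
  · intro S₁ hS₁ v₀ hv₀ hv₀S F hFH hFD
    have hsub : S₁ ⊆ S := hS₁ ▸ subset_rfl
    exact stub_twinStrictSurj hPT hPT2 W' K hadd' hK hsplit κ hκ γ 𝔭 𝔭' h𝔭 h𝔭' hne hG' S₁ (hSfin.subset hsub)
      (hnice S₁ hsub) (hfin𝔭' S₁ hsub) v₀ hv₀ hv₀S F hFH hFD
  · intro S₁ hS₁ v hpv hbad hvS hvdec F hFH hFD
    have hsub : insert v S₁ ⊆ S := Set.insert_subset ⟨hpv, hbad⟩ hS₁
    exact twinSigmaSurj hPT hPT2 W' K hadd' hK hsplit κ hκ γ 𝔭 𝔭' h𝔭 h𝔭' hne hG' S₁ (hSfin.subset hS₁)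
      (hnice S₁ hS₁) v hpv hvS hvdec (hfin𝔭' _ hsub) F hFH hFD

/-- **COMPOSITION: A (= the route item `SigmaCongruenceAtThree`, taken as the HYPOTHESIS `hA`) + B′≤ give ♭T≤ BY NAME.** `intro` ♭T≤'s binders;
`μ(𝓛′) = 0` is ♭T≤'s per-frame hypothesis `hi′` (also fed to `hA`, whose text carries it); `μ(𝓛) = 0` follows from A at the bad set (`exists_normProfile_of_sigmaCongruence`); B′≤
(derived), fed ♭T≤'s Poitou–Tate facts and the wild curve's base finiteness, gives the algebraic data and
`λ_alg(E′) + Σ′ ≤ λ_alg(E) + Σ`; stub A at B′≤'s `(T, c)` gives the analytic identity `m + Σ = m′ + Σ′`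
(`analyticIdentity_of_sigmaCongruence`); `n′ + m ≤ n + m′` by cancellation. [cite: GreenbergVatsal2000, Thm. (1.4) and (1.5)] -/
theorem defectTransportModThreePT_of_sigmaCongruenceAtThree
    (hA : Summit.BirchSwinnertonDyer.BirchSwinnertonDyer.Theses.UniversalToricDescent.SigmaCongruenceAtThree) :
    Summit.BirchSwinnertonDyer.BirchSwinnertonDyer.Theses.UniversalToricDescent.DefectTransportModThreePT := by
  unfold Summit.BirchSwinnertonDyer.BirchSwinnertonDyer.Theses.UniversalToricDescent.DefectTransportModThreePT
  intro hPT hPT2 W _ _ W' _ _ N N' _ _ K _ _ Dt Dt' hO6 hsurj hr hN hcong hadd hN' hK hHe hHe' hfinE κ hκ γ _ 𝔭 𝔭' h𝔭 he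
    hf h𝔭' hne ι' hbr hT ΩK Ωp L hΩK hΩp hL hle ΩK' Ωp' L' hΩK' hΩp' hL' hi'
  haveI : Fact (Nat.Prime 3) := ⟨Nat.prime_three⟩
  -- A at `(𝓛, 𝓛′)`
  have hAL := hA W W' N N' K Dt Dt' hO6 hsurj hr hN hcong hadd hN' hK hHe hHe' κ hκ γ 𝔭 h𝔭 he hf
    𝔭' h𝔭' hne ι' hbr ΩK Ωp L hΩK hΩp hL ΩK' Ωp' L' hΩK' hΩp' hL' hi'
  -- `μ(𝓛) = 0`: instantiate A at the finite bad set with its exact indices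
  set S : Set (HeightOneSpectrum (𝓞 K)) := {v | ((3 : ℕ) : 𝓞 K) ∉ v.asIdeal ∧
    (¬ (W.baseChange K).HasGoodReductionAt v ∨ ¬ (W'.baseChange K).HasGoodReductionAt v)} with hSdef
  have hSfin : S.Finite := by
    refine (((W.baseChange K).finite_badPlaces_holds (𝓞 K)).union
      ((W'.baseChange K).finite_badPlaces_holds (𝓞 K))).subset fun v hv ↦ ?_
    rcases hv.2 with h | h
    · exact Or.inl h
    · exact Or.inr h
  have hSdec : ∀ v ∈ S, ¬ (decomp v ≤ κ.kerSubgroup) := by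
    intro v hv
    rcases hv.2 with h | h
    · exact UniversalToricDescentTorsionMuTransportHeegner.not_decomp_le_kerSubgroup_of_not_hasGoodReductionAt_baseChange
        W hN K hK hHe (by decide) κ hκ hv.1 h
    · exact UniversalToricDescentTorsionMuTransportHeegner.not_decomp_le_kerSubgroup_of_not_hasGoodReductionAt_baseChange
        W' hN' K hK hHe' (by decide) κ hκ hv.1 h
  choose! c₀ hc₀ using fun v (hv : v ∈ hSfin.toFinset) ↦
    UniversalToricDescentSigmaLocalStabilizer.exists_pow_and_forall_dvd_of_not_le κ v
      (hSdec v (hSfin.mem_toFinset.mp hv))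
  obtain ⟨e₀, u₀, hu₀, he₀, hcong₀⟩ := hAL hSfin.toFinset c₀ (by rw [Set.Finite.coe_toFinset])
    (fun v hv ↦ ⟨(hc₀ v hv).1, (hc₀ v hv).2.2⟩)
  have hi : ∃ i : ℕ, ‖((PowerSeries.coeff i L : unrIntegers 3) : ℂ_[3])‖ = 1 := by
    obtain ⟨m, -, hm, -, -⟩ := exists_normProfile_of_sigmaCongruence (W.baseChange K) (W'.baseChange K)
      hSfin.toFinset (fun v hv ↦ (hSfin.mem_toFinset.mp hv).1) e₀ (fun v hv ↦ (he₀ v hv).1) hi' hu₀ hcong₀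
    exact ⟨m, hm.2⟩
  -- B′
  obtain ⟨T, c, s, s', hTS, hdata, ⟨g, hg, hglt, hgeq⟩, hT', ⟨g', hg', hglt', hgeq'⟩, hsum⟩ :=
    oneSidedTransport hPT hPT2 W W' N N' K hO6 hsurj hr hN hcong hadd hN' hK hHe hHe' hfinE κ hκ γ 𝔭' h𝔭' hT L
      hle hi
  have hTp : ∀ v ∈ T, ((3 : ℕ) : 𝓞 K) ∉ v.asIdeal := fun v hv ↦ by
    have h : v ∈ (↑T : Set (HeightOneSpectrum (𝓞 K))) := Finset.mem_coe.mpr hv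
    rw [hTS] at h
    exact h.1
  -- A at B′'s data, then the analytic identity
  obtain ⟨e, u, hu, he', hcongT⟩ := hAL T c hTS (fun v hv ↦ ⟨(hdata v hv).1, (hdata v hv).2.1⟩)
  obtain ⟨m, m', hm, hm', hsum'⟩ :=
    analyticIdentity_of_sigmaCongruence W W' K κ T c s s' hTp hdata e he' hi' hu hcongT
  exact ⟨g, g', _, m, _, m', hg, hg', ⟨hglt, hgeq⟩, hm, ⟨hglt', hgeq'⟩, hm', by omega⟩

end Summit.BirchSwinnertonDyer.BirchSwinnertonDyer.Theorems.UniversalToricDescentDefectTransportModThreePTOfSigmaCongruence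

namespace Summit.BirchSwinnertonDyer.BirchSwinnertonDyer.Theorems

/-- **Item stmt-BirchSwinnertonDyer-27121 (B″) `DefectTransportModThreePTOfSigmaCongruence`, proved BY NAME:** the Σ-depleted
congruence of the BDP frames at the wild prime `3` (A = `SigmaCongruenceAtThree`) implies the one-sided defect transport ♭T≤
`DefectTransportModThreePT` — Greenberg–Vatsal's λ-transport along `E[3] ≅ E′[3]` for the O6 twin pair in the anticyclotomic tower,
rank-free, composed with A.  [cite: GreenbergVatsal2000, Thm. (1.4), §2 Prop. (2.1), Cor. (2.3)] [cite: LeiMullerXia2023, Thm. 5.1] -/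
theorem defectTransportModThreePTOfSigmaCongruence_proof :
    Summit.BirchSwinnertonDyer.BirchSwinnertonDyer.Theses.UniversalToricDescent.DefectTransportModThreePTOfSigmaCongruence := by
  unfold Summit.BirchSwinnertonDyer.BirchSwinnertonDyer.Theses.UniversalToricDescent.DefectTransportModThreePTOfSigmaCongruence
  intro hA
  exact UniversalToricDescentDefectTransportModThreePTOfSigmaCongruence.defectTransportModThreePT_of_sigmaCongruenceAtThree hA

end Summit.BirchSwinnertonDyer.BirchSwinnertonDyer.Theorems

end
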